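import Mathlib
import HarnessLib

/-!
# Ko Chao (1965): `x ^ 2 - y ^ q = 1` has no solution in non-zero integers for a prime `q ≥ 5`

This is the case "`p = 2`" of Catalan's equation `x ^ p - y ^ q = 1` [Schoof2009, Chapter 3],
the second of the four cases into which the proof of Catalan's conjecture
(`Literature.NumberTheory.DiophantineGeometry.mihailescu`, abc.S19) splits. We formalise the
proof of E. Z. Chein (1976) as printed in R. Schoof, *Catalan's Conjecture*, Universitext (2008),
Lemmas 3.1–3.3 and Corollary 3.4 (pp. 11–13):

* `Catalan.odd_of_sq_sub_pow` — a solution has `x` odd (two `q`-th powers differing by `2` are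
  `-1, 1`), the first step of [Schoof2009, Lemma 3.1];
* `Catalan.exists_pow_eq_of_mod_four` — [Schoof2009, Lemma 3.1 (i)]: normalising
  `x ≡ 1 (mod 4)`,
  `x - 1 = 2 ^ (q-1) a ^ q`, `x + 1 = 2 b ^ q` with `a ≠ 0`, `b` odd, `gcd(a, b) = 1`;
* `Catalan.nagell_dvd` — [Schoof2009, Lemma 3.2] (T. Nagell): `q ∣ x`, via the unit
  `x + y ^ ((q-1)/2) √y` of `ℤ[√y]`, `y = u ² - 1`, and Mathlib's description (`Pell.eq_pell`)
  of the solutions of the Pell equation `X ² - (u ² - 1) Y ² = 1`;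
* `Catalan.dvd_sub_three_of_mod_four` — [Schoof2009, Lemma 3.3]: `x ≡ 3 (mod q)` once
  `x ≡ 1 (mod 4)`;
* `Catalan.koChao` — [Schoof2009, Corollary 3.4].

Everything here is proved; no named facts are introduced.
-/

namespace Literature.NumberTheory.DiophantineGeometry

namespace Catalan

open Finset

/-! ### Two `q`-th powers differing by `2` -/

/-- For `s ≥ 1` and `q ≥ 1`, `(s + 1) ^ q ≥ s ^ q + q`. [folklore] -/
theorem pow_add_le_succ_pow {s : ℤ} (hs : 1 ≤ s) :
    ∀ q : ℕ, 1 ≤ q → s ^ q + q ≤ (s + 1) ^ q := by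
  intro q hq
  induction q with
  | zero => omega
  | succ n ih =>
    rcases Nat.eq_zero_or_pos n with rfl | hn
    · simp
    · have ih' := ih hn
      have hsn : 1 ≤ s ^ n := one_le_pow₀ hs
      push_cast
      calc s ^ (n + 1) + (n + 1 : ℤ) ≤ (s + 1) * (s ^ n + n) := by rw [pow_succ]; nlinarith
        _ ≤ (s + 1) * (s + 1) ^ n := by
          exact mul_le_mul_of_nonneg_left ih' (by linarith)
        _ = (s + 1) ^ (n + 1) := by ring

/-- Two `q`-th powers (`q ≥ 3` odd) that differ by `2` are `(-1) ^ q` and `1 ^ q`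
[Schoof2009, proof of Lemma 3.1]. [cite: Schoof2009, Lemma 3.1] -/
theorem eq_of_pow_sub_pow_eq_two {s t : ℤ} {q : ℕ} (hq : Odd q) (hq3 : 3 ≤ q)
    (h : t ^ q - s ^ q = 2) : s = -1 ∧ t = 1 := by
  have hmono : StrictMono fun v : ℤ => v ^ q := hq.strictMono_pow
  -- an auxiliary claim: `t ≥ 2` is impossible
  have aux : ∀ s t : ℤ, t ^ q - s ^ q = 2 → 2 ≤ t → False := by
    intro s t h ht
    have h2q : (2 : ℤ) ^ q ≥ 8 := by
      calc (2 : ℤ) ^ q ≥ 2 ^ 3 := pow_le_pow_right₀ (by norm_num) hq3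
        _ = 8 := by norm_num
    have htq : (2 : ℤ) ^ q ≤ t ^ q := pow_le_pow_left₀ (by norm_num) ht q
    have hs1 : 1 < s := by
      by_contra hs
      push Not at hs
      have : s ^ q ≤ 1 ^ q := hmono.monotone hs
      rw [one_pow] at this
      linarith
    have hst : s < t := hmono.lt_iff_lt.1 (show s ^ q < t ^ q by linarith)
    have h1 : (s + 1) ^ q ≤ t ^ q := pow_le_pow_left₀ (by linarith) (by linarith) q
    have h2 := pow_add_le_succ_pow (le_of_lt hs1) q (by omega)
    have : (3 : ℤ) ≤ q := by exact_mod_cast hq3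
    linarith
  by_cases ht : 2 ≤ t
  · exact (aux s t h ht).elim
  by_cases hs : s ≤ -2
  · refine (aux (-t) (-s) ?_ (by linarith)).elim
    rw [hq.neg_pow, hq.neg_pow]
    linarith
  push Not at ht hs
  have hst : s < t := hmono.lt_iff_lt.1 (show s ^ q < t ^ q by linarith)
  have ht0 : 0 ≤ t := by omega
  have hs0 : s ≤ 0 := by omega
  interval_cases t <;> interval_cases s <;>
    simp [hq.neg_one_pow, zero_pow (by omega : q ≠ 0)] at h ⊢

/-- [Schoof2009, proof of Lemma 3.1]: if `q ≥ 3` is odd, `x ≠ 0` and `x ^ 2 - y ^ q = 1`, then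
`x` is odd (otherwise `x ± 1` are coprime `q`-th powers differing by `2`, forcing `x = 0`).
[cite: Schoof2009, Lemma 3.1] -/
theorem odd_of_sq_sub_pow {x y : ℤ} {q : ℕ} (hq : Odd q) (hq3 : 3 ≤ q) (hx : x ≠ 0)
    (h : x ^ 2 - y ^ q = 1) : Odd x := by
  by_contra hxo
  obtain ⟨m, rfl⟩ : Even x := Int.not_odd_iff_even.1 hxo
  have hcop : IsCoprime (m + m - 1) (m + m + 1) := ⟨m, 1 - m, by ring⟩
  have hprod : (m + m - 1) * (m + m + 1) = y ^ q := by linear_combination h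
  obtain ⟨⟨s, hs⟩, ⟨t, ht⟩⟩ := Int.eq_pow_of_mul_eq_pow_odd hcop hq hprod
  have hts : t ^ q - s ^ q = 2 := by rw [← hs, ← ht]; ring
  obtain ⟨rfl, -⟩ := eq_of_pow_sub_pow_eq_two hq hq3 hts
  rw [hq.neg_one_pow] at hs
  exact hx (by linarith)

/-- If `q ≥ 1` and `y ^ q` is even then `y` is even. [folklore] -/
theorem even_of_even_pow {y : ℤ} {q : ℕ} (h : Even (y ^ q)) : Even y :=
  (Int.even_pow.1 h).1

/-- **[Schoof2009, Lemma 3.1 (i)]**: let `q ≥ 3` be odd and `x, y` non-zero integers with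
`x ^ 2 - y ^ q = 1`, normalised (replacing `x` by `-x` if necessary) so that `x ≡ 1 (mod 4)`. Then
`x - 1 = 2 ^ (q-1) a ^ q` and `x + 1 = 2 b ^ q` for integers `a ≠ 0`, `b` odd, `gcd(a, b) = 1`.
[cite: Schoof2009, Lemma 3.1] -/
theorem exists_pow_eq_of_mod_four {x y : ℤ} {q : ℕ} (hq : Odd q) (hq3 : 3 ≤ q) (hx : x ≠ 0)
    (hy : y ≠ 0) (h : x ^ 2 - y ^ q = 1) (hx4 : x % 4 = 1) :
    ∃ a b : ℤ, x - 1 = 2 ^ (q - 1) * a ^ q ∧ x + 1 = 2 * b ^ q ∧ a ≠ 0 ∧ Odd b ∧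
      IsCoprime a b := by
  -- `x = 4 k + 1`
  obtain ⟨k, rfl⟩ : ∃ k, x = 4 * k + 1 := ⟨x / 4, by omega⟩
  -- `y` is even, `y = 2 w`
  have hyq : y ^ q = 8 * (k * (2 * k + 1)) := by linear_combination -h
  obtain ⟨w, rfl⟩ : Even y := by
    refine even_of_even_pow (q := q) ?_
    rw [hyq]
    exact ⟨4 * (k * (2 * k + 1)), by ring⟩
  -- `2 ^ (q-3) ∣ k`
  obtain ⟨n, hn3⟩ : ∃ n, q = n + 3 := ⟨q - 3, by omega⟩
  have hpow : (w + w) ^ q = 8 * (2 ^ n * w ^ q) := by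
    rw [← two_mul, mul_pow, hn3, pow_add]; ring
  have hk : 2 ^ n * w ^ q = k * (2 * k + 1) := by
    have := hyq
    rw [hpow] at this
    linarith
  have h2k : (2 : ℤ) ^ n ∣ k := by
    have hodd : IsCoprime ((2 : ℤ) ^ n) (2 * k + 1) :=
      IsCoprime.pow_left ⟨-k, 1, by ring⟩
    exact hodd.dvd_of_dvd_mul_right ⟨w ^ q, by rw [← hk]⟩
  obtain ⟨k', rfl⟩ := h2k
  -- `w ^ q = k' (2 k + 1)` with coprime factors
  have hwq : k' * (2 * (2 ^ n * k') + 1) = w ^ q := by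
    have h2n : (2 : ℤ) ^ n ≠ 0 := pow_ne_zero _ two_ne_zero
    apply mul_left_cancel₀ h2n
    rw [hk]
    ring
  have hcop : IsCoprime k' (2 * (2 ^ n * k') + 1) := ⟨-(2 * 2 ^ n), 1, by ring⟩
  obtain ⟨⟨a, ha⟩, ⟨b, hb⟩⟩ := Int.eq_pow_of_mul_eq_pow_odd hcop hq hwq
  refine ⟨a, b, ?_, ?_, ?_, ?_, ?_⟩
  · rw [← ha, show q - 1 = n + 2 by omega, pow_add]; ring
  · rw [← hb]; ring
  · rintro rfl
    rw [zero_pow (by omega)] at ha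
    subst ha
    have hw : w ^ q = 0 := by rw [← hwq]; ring
    obtain rfl := (pow_eq_zero_iff (by omega)).1 hw
    simp at hy
  · by_contra hbo
    have hbe : Even b := Int.not_odd_iff_even.1 hbo
    have : Even (b ^ q) := Int.even_pow.2 ⟨hbe, by omega⟩
    rw [← hb] at this
    exact Int.not_even_iff_odd.2 (odd_two_mul_add_one _) this
  · have h1 : IsCoprime (a ^ q) (b ^ q) := by rwa [← ha, ← hb]
    exact (IsCoprime.pow_left_iff (by omega)).1 ((IsCoprime.pow_right_iff (by omega)).1 h1)

/-! ### Lemma 3.2 (Nagell): `q ∣ x` -/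

/-- Congruences for the Pell sequences of `X ² - (a ² - 1) Y ² = 1` modulo `d = a ² - 1`:
`xₙ ≡ a ^ n` and `a · yₙ ≡ n a ^ n (mod d)` — i.e.
`(a + √d) ^ n ≡ a ^ n + n a ^ (n-1) √d` modulo `d ℤ[√d]` [Schoof2009, proof of Lemma 3.2].
[cite: Schoof2009, Lemma 3.2] -/
theorem pell_dvd_xz_sub_pow_and {a : ℕ} (a1 : 1 < a) (n : ℕ) :
    ((a : ℤ) * a - 1 ∣ Pell.xz a1 n - (a : ℤ) ^ n) ∧
      ((a : ℤ) * a - 1 ∣ Pell.yz a1 n * a - n * (a : ℤ) ^ n) := by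
  induction n with
  | zero => simp [Pell.xz, Pell.yz]
  | succ n ih =>
    obtain ⟨ih1, ih2⟩ := ih
    rw [Pell.xz_succ, Pell.yz_succ, Pell.dz_val]
    simp only [Pell.az]
    constructor
    · have e :
          Pell.xz a1 n * (a : ℤ) + ((a : ℤ) * a - 1) * Pell.yz a1 n - (a : ℤ) ^ (n + 1) =
          (Pell.xz a1 n - (a : ℤ) ^ n) * a + ((a : ℤ) * a - 1) * Pell.yz a1 n := by ring
      rw [e]
      exact dvd_add (ih1.mul_right _) (dvd_mul_right _ _)
    · have e :
          (Pell.xz a1 n + Pell.yz a1 n * (a : ℤ)) * a -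
              ((n + 1 : ℕ) : ℤ) * (a : ℤ) ^ (n + 1) =
          (Pell.xz a1 n - (a : ℤ) ^ n) * a + (Pell.yz a1 n * a - n * (a : ℤ) ^ n) * a := by
        push_cast; ring
      rw [e]
      exact dvd_add (ih1.mul_right _) (ih2.mul_right _)

/-- For the Pell sequences of `X ² - (a ² - 1) Y ² = 1`, `a ∣ y₂ₖ` — i.e.
`(a + √d) ^ (2k) ≡ (a ² - 1) ^ k (mod a ℤ[√d])` [Schoof2009, proof of Lemma 3.2].
[cite: Schoof2009, Lemma 3.2] -/
theorem pell_dvd_yz_two_mul {a : ℕ} (a1 : 1 < a) (k : ℕ) :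
    (a : ℤ) ∣ Pell.yz a1 (2 * k) := by
  induction k with
  | zero => simp [Pell.yz]
  | succ k ih =>
    rw [show 2 * (k + 1) = 2 * k + 2 by ring, Pell.yz_succ_succ]
    refine dvd_sub (Dvd.dvd.mul_right ?_ _) ih
    push_cast
    exact dvd_mul_left _ _

/-- **[Schoof2009, Lemma 3.2]** (T. Nagell): let `q ≥ 3` be prime and `x, y` non-zero integers
with `x ^ 2 - y ^ q = 1`; then `q ∣ x`. Proof as printed: otherwise `y + 1` and
`(y ^ q + 1)/(y + 1)` are coprime with product `x ²`, so `y + 1 = u ²`; then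
`x + y ^ ((q-1)/2) √y` is a unit of `ℤ[√y]`, `y = u ² - 1`, hence `± (u + √y) ^ m`
(`Pell.eq_pell`); reducing modulo `y` gives `y ∣ m`, so `m` is even (`y` is even by Lemma 3.1),
and reducing modulo `u` gives `u ∣ y ^ ((q-1)/2)`, so `u = ±1` and `y = 0`.
[cite: Schoof2009, Lemma 3.2] -/
theorem nagell_dvd {x y : ℤ} {q : ℕ} (hq : q.Prime) (hq3 : 3 ≤ q) (hx : x ≠ 0)
    (hy : y ≠ 0) (h : x ^ 2 - y ^ q = 1) : (q : ℤ) ∣ x := by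
  have hqo : Odd q := hq.odd_of_ne_two (by omega)
  by_contra hqx
  -- `x` is odd, `y` is even and `y ≥ 2`
  have hxo : Odd x := odd_of_sq_sub_pow hqo hq3 hx h
  have hye : Even y := by
    refine even_of_even_pow (q := q) ?_
    rw [show y ^ q = x ^ 2 - 1 by linarith]
    exact hxo.pow.sub_odd odd_one
  have hy0 : 0 ≤ y := by
    have hx2 : 0 < x ^ 2 := by positivity
    exact hqo.pow_nonneg_iff.1 (by linarith)
  have hy2 : 2 ≤ y := by obtain ⟨w, rfl⟩ := hye; omega
  -- the factorisation `y ^ q + 1 = (y + 1) Φ`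
  set Φ := ∑ i ∈ range q, y ^ i * (-1) ^ (q - 1 - i) with hΦ
  have hfac : Φ * (y + 1) = y ^ q + 1 := by
    have e := geom_sum₂_mul y (-1) q
    rw [hqo.neg_pow, one_pow, sub_neg_eq_add, sub_neg_eq_add] at e
    exact e
  have hprod : (y + 1) * Φ = x ^ 2 := by linear_combination hfac - h
  -- `y + 1` and `Φ` are coprime, since `q ∤ x`
  have hqZ : Prime (q : ℤ) := Nat.prime_iff_prime_int.1 hq
  have hcop : IsCoprime (y + 1) Φ := by
    rw [Int.isCoprime_iff_gcd_eq_one]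
    have hg1 : ((Int.gcd (y + 1) Φ : ℕ) : ℤ) ∣ y + 1 := Int.gcd_dvd_left _ _
    have hg2 : ((Int.gcd (y + 1) Φ : ℕ) : ℤ) ∣ Φ := Int.gcd_dvd_right _ _
    have hgq : ((Int.gcd (y + 1) Φ : ℕ) : ℤ) ∣ (q : ℤ) := by
      have hsub : ((Int.gcd (y + 1) Φ : ℕ) : ℤ) ∣ y - (-1) := by simpa using hg1
      have h1 := (dvd_geom_sum₂_iff_of_dvd_sub hsub).1 hg2
      have he : Even (q - 1) := Nat.Odd.sub_odd hqo odd_one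
      rwa [he.neg_one_pow, mul_one] at h1
    rcases (Nat.dvd_prime hq).1 (by exact_mod_cast hgq) with hg | hg
    · exact hg
    · exfalso
      refine hqx (hqZ.dvd_of_dvd_pow (n := 2) ?_)
      rw [← hprod, ← hg]
      exact hg1.mul_right _
  -- hence `y + 1 = u ²`
  obtain ⟨u, hu⟩ := Int.sq_of_isCoprime hcop hprod
  have hu' : y + 1 = u ^ 2 := by
    rcases hu with hu | hu
    · exact hu
    · nlinarith [sq_nonneg u]
  -- `a = |u| ≥ 2` and `y = a ² - 1`
  set a := u.natAbs with ha
  have hay : (a : ℤ) * a - 1 = y := by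
    have e : (a : ℤ) * a = u ^ 2 := by rw [ha, Int.natCast_natAbs, abs_mul_abs_self, sq]
    linarith
  have a1 : 1 < a := by
    by_contra h1
    push Not at h1
    interval_cases a <;> simp at hay <;> omega
  -- the Pell solution `(|x|, y ^ m)`, `q = 2 m + 1`
  obtain ⟨m, hm⟩ : ∃ m, q = 2 * m + 1 := hqo
  have hm1 : 1 ≤ m := by omega
  set Y := y ^ m with hY
  have hY0 : 0 ≤ Y := pow_nonneg hy0 _
  have hpellZ : x ^ 2 = y * Y * Y + 1 := by
    rw [hY, show y * y ^ m * y ^ m = y ^ (2 * m + 1) by ring, ← hm]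
    linarith
  have hD : ((a * a - 1 : ℕ) : ℤ) = y := by
    rw [Nat.cast_sub (Nat.one_le_iff_ne_zero.2 (by positivity)), Nat.cast_mul, Nat.cast_one]
    exact hay
  have hpellN : x.natAbs * x.natAbs - (a * a - 1) * Y.natAbs * Y.natAbs = 1 := by
    have key : x.natAbs * x.natAbs = (a * a - 1) * Y.natAbs * Y.natAbs + 1 := by
      have e : ((x.natAbs * x.natAbs : ℕ) : ℤ) =
          (((a * a - 1) * Y.natAbs * Y.natAbs + 1 : ℕ) : ℤ) := by
        rw [Nat.cast_mul, Int.natCast_natAbs, abs_mul_abs_self, Nat.cast_add, Nat.cast_mul,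
          Nat.cast_mul, hD, Int.natAbs_of_nonneg hY0, Nat.cast_one, ← sq]
        exact hpellZ
      exact_mod_cast e
    omega
  obtain ⟨n, -, hyn⟩ := Pell.eq_pell a1 hpellN
  have hyz : (Y : ℤ) = Pell.yz a1 n := by
    rw [← Int.natAbs_of_nonneg hY0, hyn]
    rfl
  -- reduction modulo `y`: `y ∣ n`
  have hyY : y ∣ Y := by
    rw [hY, show m = (m - 1) + 1 by omega, pow_succ]
    exact dvd_mul_left _ _
  have hyn' : y ∣ (n : ℤ) := by
    have h1 := (pell_dvd_xz_sub_pow_and a1 n).2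
    rw [hay, ← hyz] at h1
    have h2 : y ∣ (n : ℤ) * (a : ℤ) ^ n := by
      have := dvd_sub (hyY.mul_right (a : ℤ)) h1
      rwa [sub_sub_cancel] at this
    have hcop' : IsCoprime y ((a : ℤ) ^ n) := by
      refine IsCoprime.pow_right ⟨-1, a, ?_⟩
      rw [← hay]
      ring
    exact hcop'.dvd_of_dvd_mul_right h2
  -- `y` is even, hence so is `n`
  obtain ⟨k, hk⟩ : Even n := by
    have h2 : (2 : ℤ) ∣ (n : ℤ) := (even_iff_two_dvd.1 hye).trans hyn'
    exact even_iff_two_dvd.2 (by exact_mod_cast h2)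
  -- reduction modulo `u`: `a ∣ y ^ m`, so `a = 1`
  have haY : (a : ℤ) ∣ Y := by
    rw [hyz, hk, ← two_mul]
    exact pell_dvd_yz_two_mul a1 k
  have hcopay : IsCoprime (a : ℤ) Y := by
    refine IsCoprime.pow_right ⟨a, -1, ?_⟩
    rw [← hay]
    ring
  have hunit : IsUnit (a : ℤ) := hcopay.isUnit_of_dvd' dvd_rfl haY
  rw [Int.isUnit_iff_natAbs_eq, Int.natAbs_natCast] at hunit
  omega

/-! ### Lemma 3.3 (`x ≡ ±3 (mod q)`) and Ko Chao's theorem -/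

/-- **[Schoof2009, Lemma 3.3]**: let `q ≥ 5` be prime and `x, y` non-zero integers with
`x ^ 2 - y ^ q = 1`, normalised so that `x ≡ 1 (mod 4)`; then `x ≡ 3 (mod q)`. Proof as printed:
with `x - 1 = 2 ^ (q-1) a ^ q`, `x + 1 = 2 b ^ q` (Lemma 3.1) one has
`b ^ (2q) - (2a) ^ q = ((x - 3)/2) ²`; the gcd of `b ² - 2a` and the cofactor divides `q`, and it
is not `1`: otherwise `b ² - 2a` is a square `c ² ≠ b ²`, so `2|a| ≥ 2|b| - 1`,
`|a| ≥ |b|`, while `|a| ^ q = |x - 1| / 2 ^ (q-1) < |x + 1| / 2 = |b| ^ q`. Hence `q` divides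
`((x - 3)/2) ²`.
[cite: Schoof2009, Lemma 3.3] -/
theorem dvd_sub_three_of_mod_four {x y : ℤ} {q : ℕ} (hq : q.Prime) (hq5 : 5 ≤ q)
    (hx : x ≠ 0) (hy : y ≠ 0) (h : x ^ 2 - y ^ q = 1) (hx4 : x % 4 = 1) :
    (q : ℤ) ∣ x - 3 := by
  have hqo : Odd q := hq.odd_of_ne_two (by omega)
  have hqZ : Prime (q : ℤ) := Nat.prime_iff_prime_int.1 hq
  obtain ⟨a, b, ha, hb, ha0, hbo, hab⟩ := exists_pow_eq_of_mod_four hqo (by omega) hx hy h hx4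
  obtain ⟨k, rfl⟩ : ∃ k, x = 4 * k + 1 := ⟨x / 4, by omega⟩
  have hk0 : k ≠ 0 := by
    rintro rfl
    apply hy
    have : y ^ q = 0 := by linarith
    exact pow_eq_zero_iff (by omega) |>.1 this
  -- the key identity `(b ²) ^ q - (2a) ^ q = (2k - 1) ²`, `2k - 1 = (x - 3)/2`
  have hbq : b ^ q = 2 * k + 1 := by linarith
  have haq : (2 * a) ^ q = 8 * k := by
    have h2 : (2 : ℤ) ^ q = 2 * 2 ^ (q - 1) := by
      rw [← pow_succ']; congr 1; omega
    rw [mul_pow, h2]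
    linear_combination (-2 : ℤ) * ha
  have hkey : (b ^ 2) ^ q - (2 * a) ^ q = (2 * k - 1) ^ 2 := by
    rw [← pow_mul, mul_comm, pow_mul, hbq, haq]; ring
  -- factor `B ^ q - A ^ q = (B - A) Ψ`
  set Ψ := ∑ i ∈ range q, (b ^ 2) ^ i * (2 * a) ^ (q - 1 - i) with hΨ
  have hprod : (b ^ 2 - 2 * a) * Ψ = (2 * k - 1) ^ 2 := by
    rw [mul_comm, hΨ, geom_sum₂_mul, hkey]
  -- `2a` is coprime to `b ² - 2a`
  have hAB : IsCoprime (2 * a) (b ^ 2) :=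
    (IsCoprime.mul_left (Int.isCoprime_two_left.2 hbo) hab).pow_right
  have hA : IsCoprime (2 * a) (b ^ 2 - 2 * a) := by
    have := hAB.add_mul_left_right (-1)
    rwa [show b ^ 2 + 2 * a * -1 = b ^ 2 - 2 * a by ring] at this
  -- the gcd divides `q`
  have hg1 : ((Int.gcd (b ^ 2 - 2 * a) Ψ : ℕ) : ℤ) ∣ b ^ 2 - 2 * a := Int.gcd_dvd_left _ _
  have hg2 : ((Int.gcd (b ^ 2 - 2 * a) Ψ : ℕ) : ℤ) ∣ Ψ := Int.gcd_dvd_right _ _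
  have hgq : ((Int.gcd (b ^ 2 - 2 * a) Ψ : ℕ) : ℤ) ∣ (q : ℤ) := by
    have h1 := (dvd_geom_sum₂_iff_of_dvd_sub hg1).1 hg2
    have hcop : IsCoprime ((Int.gcd (b ^ 2 - 2 * a) Ψ : ℕ) : ℤ) ((2 * a) ^ (q - 1)) :=
      (hA.symm.of_isCoprime_of_dvd_left hg1).pow_right
    exact hcop.dvd_of_dvd_mul_right h1
  rcases (Nat.dvd_prime hq).1 (by exact_mod_cast hgq) with hg | hg
  · -- gcd `= 1`: both factors are squares up to sign, which is impossible by size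
    exfalso
    have hcop : IsCoprime (b ^ 2 - 2 * a) Ψ := Int.isCoprime_iff_gcd_eq_one.2 hg
    obtain ⟨e, he⟩ := Int.sq_of_isCoprime hcop hprod
    have hBA : 2 * a ≤ b ^ 2 := by
      have h1 : (2 * a) ^ q ≤ (b ^ 2) ^ q := by nlinarith [hkey, sq_nonneg (2 * k - 1)]
      exact (hqo.strictMono_pow).le_iff_le.1 h1
    obtain ⟨f, hf⟩ : ∃ f, b ^ 2 - 2 * a = f ^ 2 := by
      rcases he with he | he
      · exact ⟨e, he⟩
      · exact ⟨0, by nlinarith [sq_nonneg e]⟩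
    -- `|b| ≤ |a|` by comparing `b ²` with the nearest squares
    have hle : |b| ≤ |a| := by
      have hbf : |f| ≠ |b| := by
        intro hh
        apply ha0
        have : f ^ 2 = b ^ 2 := by rw [← sq_abs f, hh, sq_abs]
        linarith
      rcases lt_or_gt_of_ne hbf with hlt | hgt
      · have h1 : |f| + 1 ≤ |b| := hlt
        have h2 : |f| ^ 2 ≤ (|b| - 1) ^ 2 := by nlinarith [abs_nonneg f]
        rw [sq_abs] at h2
        have h3 : 2 * |b| - 1 ≤ 2 * a := by nlinarith [sq_abs b]
        calc |b| ≤ a := by linarith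
          _ ≤ |a| := le_abs_self a
      · have h1 : |b| + 1 ≤ |f| := hgt
        have h2 : (|b| + 1) ^ 2 ≤ |f| ^ 2 := by nlinarith [abs_nonneg b]
        rw [sq_abs] at h2
        have h3 : 2 * a ≤ -(2 * |b|) - 1 := by nlinarith [sq_abs b]
        calc |b| ≤ -a := by linarith
          _ ≤ |a| := neg_le_abs a
    -- `|a| < |b|` by size
    have hlt : |a| < |b| := by
      refine lt_of_pow_lt_pow_left₀ q (abs_nonneg b) ?_
      rw [← abs_pow, ← abs_pow]
      have hT : (16 : ℤ) ≤ 2 ^ (q - 1) :=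
        calc (16 : ℤ) = 2 ^ 4 := by norm_num
          _ ≤ 2 ^ (q - 1) := pow_le_pow_right₀ (by norm_num) (by omega)
      have hP : (2 : ℤ) ^ (q - 1) * a ^ q = 4 * k := by linarith
      have h16 : 16 * |a ^ q| ≤ |4 * k| := by
        calc 16 * |a ^ q| ≤ 2 ^ (q - 1) * |a ^ q| :=
              mul_le_mul_of_nonneg_right hT (abs_nonneg _)
          _ = |2 ^ (q - 1) * a ^ q| := by
              rw [abs_mul, abs_of_pos (by positivity : (0 : ℤ) < 2 ^ (q - 1))]
          _ = |4 * k| := by rw [hP]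
      rw [hbq]
      rcases le_or_gt 0 k with hk | hk
      · rw [abs_of_nonneg (by linarith : (0 : ℤ) ≤ 4 * k)] at h16
        rw [abs_of_nonneg (by linarith : (0 : ℤ) ≤ 2 * k + 1)]
        have : 0 < k := lt_of_le_of_ne hk (Ne.symm hk0)
        linarith [abs_nonneg (a ^ q)]
      · rw [abs_of_neg (by linarith : (4 : ℤ) * k < 0)] at h16
        rw [abs_of_neg (by linarith : (2 : ℤ) * k + 1 < 0)]
        linarith [abs_nonneg (a ^ q)]
    exact absurd hle (not_le.2 hlt)
  · -- gcd `= q`: `q ∣ b ² - 2a ∣ (2k - 1) ²`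
    rw [hg] at hg1
    have h1 : (q : ℤ) ∣ (2 * k - 1) ^ 2 := by rw [← hprod]; exact hg1.mul_right _
    have h2 := hqZ.dvd_of_dvd_pow h1
    rw [show (4 * k + 1 - 3 : ℤ) = 2 * (2 * k - 1) by ring]
    exact h2.mul_left 2

/-- **Ko Chao (1965)** [Schoof2009, Corollary 3.4], the case "`p = 2`, `q ≥ 5`" of Catalan's
equation: for a prime `q ≥ 5` the Diophantine equation `x ^ 2 - y ^ q = 1` has no solution in
non-zero integers `x, y` (by Lemmas 3.2 and 3.3, `x ≡ 0` and `x ≡ ±3 (mod q)`, impossible for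
`q ≠ 3`). [cite: Schoof2009, Corollary 3.4] -/
theorem koChao {x y : ℤ} {q : ℕ} (hq : q.Prime) (hq5 : 5 ≤ q) (hx : x ≠ 0) (hy : y ≠ 0) :
    x ^ 2 - y ^ q ≠ 1 := by
  intro h
  have hqo : Odd q := hq.odd_of_ne_two (by omega)
  have hxo : Odd x := odd_of_sq_sub_pow hqo (by omega) hx h
  -- normalise the sign of `x` so that `x ≡ 1 (mod 4)`
  obtain ⟨x', hx'0, h', hx'4⟩ :
      ∃ x' : ℤ, x' ≠ 0 ∧ x' ^ 2 - y ^ q = 1 ∧ x' % 4 = 1 := by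
    have hx2 : x % 4 = 1 ∨ x % 4 = 3 := by obtain ⟨r, rfl⟩ := hxo; omega
    rcases hx2 with h4 | h4
    · exact ⟨x, hx, h, h4⟩
    · exact ⟨-x, neg_ne_zero.2 hx, by rw [neg_sq]; exact h, by omega⟩
  have h1 : (q : ℤ) ∣ x' := nagell_dvd hq (by omega) hx'0 hy h'
  have h2 : (q : ℤ) ∣ x' - 3 := dvd_sub_three_of_mod_four hq hq5 hx'0 hy h' hx'4
  have h3 : (q : ℤ) ∣ 3 := by
    have := dvd_sub h1 h2
    rwa [sub_sub_cancel] at this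
  have h4 : q ∣ 3 := by exact_mod_cast h3
  have := Nat.le_of_dvd (by norm_num) h4
  omega

end Catalan

end Literature.NumberTheory.DiophantineGeometry
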